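/-
Copyright (c) 2026 the pub-hodgecm-mathlib formalisation cell (harness21).  Prover seat hodgecm-mathlib-K2Liu-p02 (g7), Track B «K2-LIT» ∕ hLiu418
#184♮, Road Φ ∕ socket #41, organ G5-a (Φ7-2), face (β0): the `act`∕`hscale`∕`hconj` letters of ★ p859905 `K2LiuMiddleInnerSectionBorelLaw.inner_law_of_unfold`
for the torus and the unipotents of the `GL₂` Borel (K2Liu-p02 (g7) bus 2026-09-04T12:29Z∕12:31Z).  THEOREMS ONLY.
-/
import Summits.HodgeConjecture.HodgeConjecture.Theorems.K2LiuUnipDeltaLeviConjugation   -- ★ p860173 (+ ★ FILE B p860079)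
import Mathlib.MeasureTheory.Measure.Haar.DistribChar
import HarnessLib

/-!
# Crux `HLiu418`, Road Φ, face (β0): THE TORUS ACTS ON THE CORNER LINE BY `t ↦ t · Nm(d₁)⁻¹` — the `act`, `hscale` and `hconj` letters of the
# inner-section Borel law for `Λ(diag(d₀, d₁))` and `Λ(1 b; 0 1)`

Cell `hodgecm-mathlib`, crux item hLiu418 = `stmt-HodgeConjecture-24832`; squad K2 ∕ K2Liu; prover K2Liu-p02 (g7).  THEOREMS ONLY (no `def`, no instance, no
notation, no named-fact hypothesis, no `sorry`); lane `--supports stmt-HodgeConjecture-24832 --as helper`.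

* §1 `baseChange_re_of_conjAdele_eq` — a `σ`-FIXED adele of `L` is the base change of its real part `(Ψ_𝔸⁻¹ x).1` (twin of ★ FILE B `baseChange_im_mul_delta`);
  **`exists_unit_baseChange_eq_norm_inv`** — for an idele `d` of `L` there is a unit `n` of `𝔸_{L⁺}` with `n ⊗ 1 = d⁻¹ · σ(d)⁻¹ = Nm(d)⁻¹`.
* §2 **`integral_comp_smul_eq_distribHaarChar_inv_smul`** — the `hscale` letter in Mathlib's currency: for an additive Haar measure `μ` on `A` and `g` acting
  distributively, `∫ φ (g • t) dμ(t) = Δ(g)⁻¹ • ∫ φ dμ`, `Δ = distribHaarChar A` (`μ ∘ (g • ·)⁻¹ = Δ(g⁻¹) • μ`).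
* §3 **`exists_corner_zero_torus_inv_conj_eq_mul`** — for `x = diag(d₀, d₁)` and the corner line `n₂` (any map with `n₂ t ∈ N_Δ(𝔸)`, `X_{n₂ t} = single 1 1 ((t ⊗ 1)δ)`, as
  delivered by ★ FILE C `exists_corner_unfold`): `Λ(x)⁻¹ · n₂(t) · Λ(x) = z · n₂(t · n)` with `z ∈ N_Δ(𝔸)`, `(X_z)₁₁ = 0` and `n ⊗ 1 = Nm(d₁)⁻¹` — the `hconj` letter with
  `act t = t · n`; **`exists_corner_zero_upper_inv_conj_eq_mul`** — for `x = (1 b; 0 1)`: the same with `act = id`.  (★ `K2LiuUnipDeltaLeviConjugation`.)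
References: [MoeglinWaldspurger1995] II.1.7; [KudlaRallis1994] §2; [DeitmarEchterhoff2014] §1.5; Bourbaki *Intégration* VII §1 no. 10 (module of an automorphism).
HONEST LABEL.  Count-neutral helper: `HC_CM` is proved only modulo the 7 printed citations (2 remaining named inputs: hLiu418 = `stmt-HodgeConjecture-24832`,
h413 = `stmt-HodgeConjecture-24833`) until rung 0 closes.
-/

set_option autoImplicit false
set_option linter.dupNamespace false -- the mandated namespace repeats `HodgeConjecture.HodgeConjecture`

noncomputable section

open scoped Matrix NNReal ENNReal Pointwise
open NumberField IsDedekindDomain MeasureTheory MeasureTheory.Measure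
open Literature.NumberTheory.Automorphic Literature.NumberTheory.Automorphic.UnitaryGroup Literature.NumberTheory.GaloisRepresentations
open Literature.NumberTheory.GelbartRogawski1991 Literature.NumberTheory.GelbartRogawski1991.GRConstruction
open Literature.NumberTheory.GelbartRogawski1991.AdaptedBlocks
open Literature.NumberTheory.K2Lit.SiegelDoubled
open UnitaryDualPair
open Summit.HodgeConjecture.HodgeConjecture.Cruxes.HLiu418.K2LiuUnipDeltaCornerCoordinates
open Summit.HodgeConjecture.HodgeConjecture.Cruxes.HLiu418.K2LiuUnipDeltaLeviConjugation

namespace Summit.HodgeConjecture.HodgeConjecture.Cruxes.HLiu418.K2LiuCornerTorusAction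

/-! ## §1 `σ`-fixed adeles are base changes; the norm of an idele as a unit of `𝔸_{L⁺}` -/

section Re

variable (L : Type) [Field L] [NumberField L] [IsCMField L]

/-- **a `σ`-fixed adele is the base change of its real part**: if `σ x = x` then `(Ψ_𝔸⁻¹ x).1 ⊗ 1 = x` (`x = a⊗1 + (b⊗1)δ`, `σ x = a⊗1 − (b⊗1)δ` ⇒ `2(b⊗1)δ = 0` ⇒ `b = 0`).
[cite: CasselsFrohlichANT1967, Ch. II §14] -/
theorem baseChange_re_of_conjAdele_eq {x : AdeleRing (𝓞 L) L} (hx : conjAdele (Fp L) L (IsCMField.complexConj L) x = x) :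
    AdeleRing.baseChange (Fp L) L
        ((quadraticAdeleEquiv (Fp L) L (IsCMField.complexConj L) (complexConj_imagUnit L) (imagUnit_ne_zero L)).symm x).1 = x := by
  set Ψ := quadraticAdeleEquiv (Fp L) L (IsCMField.complexConj L) (complexConj_imagUnit L) (imagUnit_ne_zero L) with hΨ
  set p := Ψ.symm x with hp
  have hxp : x = AdeleRing.baseChange (Fp L) L p.1 + AdeleRing.baseChange (Fp L) L p.2 * algebraMap L (AdeleRing (𝓞 L) L) (imagUnit L) := by
    rw [← quadraticAdeleEquiv_apply (E := L) (IsCMField.complexConj L) (complexConj_imagUnit L) (imagUnit_ne_zero L), ← hΨ, hp,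
      ContinuousAddEquiv.apply_symm_apply]
  have hσx : conjAdele (Fp L) L (IsCMField.complexConj L) x =
      AdeleRing.baseChange (Fp L) L p.1 - AdeleRing.baseChange (Fp L) L p.2 * algebraMap L (AdeleRing (𝓞 L) L) (imagUnit L) := by
    rw [hxp, map_add, conjAdele_baseChange' L, conjAdele_baseChange_mul_delta, ← sub_eq_add_neg]
  -- `bδ + bδ = 0`
  have hb : AdeleRing.baseChange (Fp L) L p.2 * algebraMap L (AdeleRing (𝓞 L) L) (imagUnit L) +
      AdeleRing.baseChange (Fp L) L p.2 * algebraMap L (AdeleRing (𝓞 L) L) (imagUnit L) = 0 := by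
    have h1 := hσx.symm.trans hx
    rw [hxp, sub_eq_add_neg] at h1
    have h2 : -(AdeleRing.baseChange (Fp L) L p.2 * algebraMap L (AdeleRing (𝓞 L) L) (imagUnit L)) =
        AdeleRing.baseChange (Fp L) L p.2 * algebraMap L (AdeleRing (𝓞 L) L) (imagUnit L) := _root_.add_left_cancel h1
    nth_rewrite 2 [← h2]
    exact add_neg_cancel _
  have hb0 : AdeleRing.baseChange (Fp L) L p.2 = 0 := by
    rw [← two_mul, ← mul_assoc] at hb
    have hδ : IsUnit (algebraMap L (AdeleRing (𝓞 L) L) (imagUnit L)) := (IsUnit.mk0 _ (imagUnit_ne_zero L)).map _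
    have h2b : 2 * AdeleRing.baseChange (Fp L) L p.2 = 0 := (hδ.mul_left_eq_zero).1 hb
    rw [← map_ofNat (AdeleRing.baseChange (Fp L) L) 2, ← map_mul, map_eq_zero_iff _ (AdeleRing.baseChange_injective (F := Fp L) (E := L))] at h2b
    have h2 : (2 : AdeleRing (𝓞 (Fp L)) (Fp L)) = algebraMap (Fp L) (AdeleRing (𝓞 (Fp L)) (Fp L)) 2 := by rw [map_ofNat]
    rw [h2] at h2b
    have hu : IsUnit (algebraMap (Fp L) (AdeleRing (𝓞 (Fp L)) (Fp L)) 2) := (IsUnit.mk0 (2 : Fp L) two_ne_zero).map _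
    rw [(hu.mul_right_eq_zero).1 h2b, map_zero]
  conv_rhs => rw [hxp, hb0, zero_mul, add_zero]

/-- **THE INVERSE NORM OF AN IDELE AS A UNIT OF `𝔸_{L⁺}`**: for a unit `d` of `𝔸_L` there is a unit `n` of `𝔸_{L⁺}` with `n ⊗ 1 = d⁻¹ · σ(d⁻¹)` (the `σ`-fixed adele
`Nm(d)⁻¹`; its inverse is the real part of `d σ(d)`). [cite: CasselsFrohlichANT1967, Ch. II §14] -/
theorem exists_unit_baseChange_eq_norm_inv (d : (AdeleRing (𝓞 L) L)ˣ) :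
    ∃ n : (AdeleRing (𝓞 (Fp L)) (Fp L))ˣ,
      AdeleRing.baseChange (Fp L) L (n : AdeleRing (𝓞 (Fp L)) (Fp L)) =
        ((d⁻¹ : (AdeleRing (𝓞 L) L)ˣ) : AdeleRing (𝓞 L) L) * conjAdele (Fp L) L (IsCMField.complexConj L) ((d⁻¹ : (AdeleRing (𝓞 L) L)ˣ) : AdeleRing (𝓞 L) L) := by
  have hcc : IsCMField.complexConj L * IsCMField.complexConj L = 1 := AlgEquiv.ext fun x => IsCMField.complexConj_apply_apply L x
  have hfix : ∀ y : AdeleRing (𝓞 L) L, conjAdele (Fp L) L (IsCMField.complexConj L) (y * conjAdele (Fp L) L (IsCMField.complexConj L) y) =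
      y * conjAdele (Fp L) L (IsCMField.complexConj L) y := fun y => by
    rw [map_mul, conjAdele_conjAdele (F := Fp L) (E := L) (c := IsCMField.complexConj L) hcc, mul_comm]
  set Ψ := quadraticAdeleEquiv (Fp L) L (IsCMField.complexConj L) (complexConj_imagUnit L) (imagUnit_ne_zero L) with hΨ
  set y : AdeleRing (𝓞 L) L := ((d⁻¹ : (AdeleRing (𝓞 L) L)ˣ) : AdeleRing (𝓞 L) L) * conjAdele (Fp L) L (IsCMField.complexConj L) ((d⁻¹ : (AdeleRing (𝓞 L) L)ˣ) : AdeleRing (𝓞 L) L)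
    with hy
  set y' : AdeleRing (𝓞 L) L := (d : AdeleRing (𝓞 L) L) * conjAdele (Fp L) L (IsCMField.complexConj L) (d : AdeleRing (𝓞 L) L) with hy'
  have hn : AdeleRing.baseChange (Fp L) L (Ψ.symm y).1 = y := baseChange_re_of_conjAdele_eq L (hfix _)
  have hn' : AdeleRing.baseChange (Fp L) L (Ψ.symm y').1 = y' := baseChange_re_of_conjAdele_eq L (hfix _)
  have hyy' : y * y' = 1 := by
    rw [hy, hy', mul_mul_mul_comm, ← map_mul, Units.inv_mul, map_one, mul_one]
  have h1 : (Ψ.symm y).1 * (Ψ.symm y').1 = 1 :=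
    AdeleRing.baseChange_injective (F := Fp L) (E := L) (by rw [map_mul, hn, hn', hyy', map_one])
  have h2 : (Ψ.symm y').1 * (Ψ.symm y).1 = 1 := by rw [mul_comm]; exact h1
  exact ⟨⟨(Ψ.symm y).1, (Ψ.symm y').1, h1, h2⟩, hn⟩

end Re

/-! ## §2 The `hscale` letter: an additive Haar measure scales under a distributive action by `distribHaarChar` -/

/-- **`hscale` IN MATHLIB's CURRENCY**: for an additive Haar measure `μ` on `A` and `g ∈ G` acting distributively and continuously,
`∫ φ (g • t) dμ(t) = Δ(g)⁻¹ • ∫ φ dμ` with `Δ = distribHaarChar A` (since `μ ∘ (g • ·)⁻¹ = Δ(g⁻¹) • μ`, Mathlib `distribHaarChar_mul`).  At `A = 𝔸_{L⁺}`, `G = 𝔸_{L⁺}ˣ`,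
`g = n` this is the letter `hscale : ∫ φ (act t) dμ = m · ∫ φ dμ` of ★ `inner_law_of_unfold` with `act t = n • t = n · t`, `m = Δ(n)⁻¹ = |n|_𝔸⁻¹`.
[cite: DeitmarEchterhoff2014, §1.5] -/
theorem integral_comp_smul_eq_distribHaarChar_inv_smul {G A : Type*} [Group G] [AddCommGroup A] [DistribMulAction G A] [TopologicalSpace A]
    [IsTopologicalAddGroup A] [LocallyCompactSpace A] [ContinuousConstSMul G A] [MeasurableSpace A] [BorelSpace A]
    (μ : Measure A) [μ.IsAddHaarMeasure] [μ.Regular] {E : Type*} [NormedAddCommGroup E] [NormedSpace ℝ E] (g : G) (φ : A → E) :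
    ∫ t, φ (g • t) ∂μ = ((distribHaarChar A g)⁻¹ : ℝ≥0) • ∫ t, φ t ∂μ := by
  have hmeas : Measurable fun t : A => g • t := (Homeomorph.smul g : A ≃ₜ A).continuous.measurable
  -- `μ ∘ (g • ·)⁻¹ = Δ(g⁻¹) • μ`
  have hmap : μ.map (fun t : A => g • t) = ((distribHaarChar A g⁻¹ : ℝ≥0) : ℝ≥0∞) • μ := by
    refine Measure.ext fun s hs => ?_
    rw [map_apply hmeas hs, Set.preimage_smul, Measure.smul_apply, smul_eq_mul, distribHaarChar_mul μ g⁻¹ s]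
  have hemb : MeasurableEmbedding fun t : A => g • t := (Homeomorph.smul g : A ≃ₜ A).measurableEmbedding
  rw [← hemb.integral_map, hmap, integral_smul_measure, ENNReal.coe_toReal, map_inv, NNReal.smul_def]

/-! ## §3 The `hconj` letters for the torus and the unipotents of the `GL₂` Borel -/

section Two

variable (L : Type) [Field L] [NumberField L] [IsCMField L]
variable {N M : ℕ} (e : Fin N × Fin M ≃ Fin 2)
  (dV : Fin N → L) (hdV : ∀ i, IsCMField.complexConj L (dV i) = dV i)
  (dW : Fin M → L) (hdW : ∀ i, IsCMField.complexConj L (dW i) = dW i)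
  (Λ : GL (Fin 2) (AdeleRing (𝓞 L) L) →* HA L e dV hdV dW hdW)
  (hΛ : ∀ g : GL (Fin 2) (AdeleRing (𝓞 L) L), blk L e dV hdV dW hdW (Λ g) =
    cayR (AdeleRing (𝓞 L) L) (Fin 2) * Matrix.fromBlocks (g : Matrix (Fin 2) (Fin 2) (AdeleRing (𝓞 L) L)) 0 0
      (((gramR L e dV hdV dW hdW).map ((algebraMap L (AdeleRing (𝓞 L) L)).comp (algebraMap (Fp L) L)))⁻¹ *
        (((g⁻¹ : GL (Fin 2) (AdeleRing (𝓞 L) L)) : Matrix (Fin 2) (Fin 2) (AdeleRing (𝓞 L) L)).map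
          (conjAdele (Fp L) L (IsCMField.complexConj L)))ᵀ *
        (gramR L e dV hdV dW hdW).map ((algebraMap L (AdeleRing (𝓞 L) L)).comp (algebraMap (Fp L) L))) *
      cayRinv (AdeleRing (𝓞 L) L) (Fin 2))

include hΛ in
/-- **THE `hconj` LETTER FOR THE TORUS**: for `x = diag(d₀, d₁)`, a unit `n` of `𝔸_{L⁺}` with `n ⊗ 1 = Nm(d₁)⁻¹` (★ `exists_unit_baseChange_eq_norm_inv`) and ANY corner line `n₂`
(`n₂ t ∈ N_Δ(𝔸)`, `X_{n₂ t} = single 1 1 ((t⊗1)δ)` — ★ FILE C `exists_corner_unfold`): `Λ(x)⁻¹ · n₂(t) · Λ(x) = z · n₂(t · n)` with `z ∈ N_Δ(𝔸)`, `(X_z)₁₁ = 0`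
(`z ∈ N_χ(𝔸)` by ★ α2d-2 `stabilizer_reflStd_iff`).  So `act t = t · n` and `hscale` holds with `m = Δ(n)⁻¹` (§2). [cite: MoeglinWaldspurger1995, II.1.7] [cite: KudlaRallis1994, §2] -/
theorem exists_corner_zero_torus_inv_conj_eq_mul (hdV0 : ∀ i, dV i ≠ 0) (hdW0 : ∀ i, dW i ≠ 0) (d : Fin 2 → (AdeleRing (𝓞 L) L)ˣ)
    (x : GL (Fin 2) (AdeleRing (𝓞 L) L)) (hx : (x : Matrix (Fin 2) (Fin 2) (AdeleRing (𝓞 L) L)) = Matrix.diagonal fun i => (d i : AdeleRing (𝓞 L) L))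
    (n : (AdeleRing (𝓞 (Fp L)) (Fp L))ˣ)
    (hn : AdeleRing.baseChange (Fp L) L (n : AdeleRing (𝓞 (Fp L)) (Fp L)) =
      ((d 1)⁻¹ : (AdeleRing (𝓞 L) L)ˣ) * conjAdele (Fp L) L (IsCMField.complexConj L) ↑((d 1)⁻¹))
    (n₂ : AdeleRing (𝓞 (Fp L)) (Fp L) → HA L e dV hdV dW hdW) (hn₂mem : ∀ t, n₂ t ∈ unipDelta L e dV hdV dW hdW)
    (hn₂X : ∀ t, (blk L e dV hdV dW hdW (n₂ t)).toBlocks₁₂ =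
      Matrix.single (1 : Fin 2) (1 : Fin 2) (AdeleRing.baseChange (Fp L) L t * algebraMap L (AdeleRing (𝓞 L) L) (imagUnit L)))
    (t : AdeleRing (𝓞 (Fp L)) (Fp L)) :
    ∃ z : HA L e dV hdV dW hdW, z ∈ unipDelta L e dV hdV dW hdW ∧ (blk L e dV hdV dW hdW z).toBlocks₁₂ 1 1 = 0 ∧
      (Λ x)⁻¹ * n₂ t * Λ x = z * n₂ (t * n) := by
  refine exists_corner_zero_levi_inv_conj_eq_mul L e dV hdV dW hdW Λ hΛ x (hn₂mem t) (hn₂mem _) 1 1 ?_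
  rw [hn₂X, hn₂X, levi_inv_conj_single_of_diagonal L e dV hdV dW hdW hdV0 hdW0 d x hx, Matrix.single_apply_same, Matrix.single_apply_same, map_mul, hn]
  ring

include hΛ in
/-- **THE `hconj` LETTER FOR THE UNIPOTENTS OF THE `GL₂` BOREL**: for `x = (1 b; 0 1)` and any corner line `n₂` as above, `Λ(x)⁻¹ · n₂(t) · Λ(x) = z · n₂(t)` with
`z ∈ N_Δ(𝔸)`, `(X_z)₁₁ = 0` (`act = id`, `m = 1`). [cite: MoeglinWaldspurger1995, II.1.7] [cite: KudlaRallis1994, §2] -/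
theorem exists_corner_zero_upper_inv_conj_eq_mul (hdV0 : ∀ i, dV i ≠ 0) (hdW0 : ∀ i, dW i ≠ 0) (x : GL (Fin 2) (AdeleRing (𝓞 L) L))
    (hx10 : (x : Matrix (Fin 2) (Fin 2) (AdeleRing (𝓞 L) L)) 1 0 = 0) (hx00 : (x : Matrix (Fin 2) (Fin 2) (AdeleRing (𝓞 L) L)) 0 0 = 1)
    (hx11 : (x : Matrix (Fin 2) (Fin 2) (AdeleRing (𝓞 L) L)) 1 1 = 1)
    (n₂ : AdeleRing (𝓞 (Fp L)) (Fp L) → HA L e dV hdV dW hdW) (hn₂mem : ∀ t, n₂ t ∈ unipDelta L e dV hdV dW hdW)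
    (hn₂X : ∀ t, (blk L e dV hdV dW hdW (n₂ t)).toBlocks₁₂ =
      Matrix.single (1 : Fin 2) (1 : Fin 2) (AdeleRing.baseChange (Fp L) L t * algebraMap L (AdeleRing (𝓞 L) L) (imagUnit L)))
    (t : AdeleRing (𝓞 (Fp L)) (Fp L)) :
    ∃ z : HA L e dV hdV dW hdW, z ∈ unipDelta L e dV hdV dW hdW ∧ (blk L e dV hdV dW hdW z).toBlocks₁₂ 1 1 = 0 ∧
      (Λ x)⁻¹ * n₂ t * Λ x = z * n₂ t := by
  refine exists_corner_zero_levi_inv_conj_eq_mul L e dV hdV dW hdW Λ hΛ x (hn₂mem t) (hn₂mem t) 1 1 ?_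
  rw [hn₂X, corner_levi_inv_conj_single_of_upper L e dV hdV dW hdW hdV0 hdW0 x hx10 hx00 hx11, Matrix.single_apply_same]

end Two

end Summit.HodgeConjecture.HodgeConjecture.Cruxes.HLiu418.K2LiuCornerTorusAction

end
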